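import Summits.Langlands.Langlands.Theses.QuarterDeficit1951
import Summits.Langlands.Langlands.Theorems.QuarterDeficit1951QuarterFingerprintDeficitStubParityClosure

/-!
# `QuarterFingerprintDeficit` (stmt-Langlands-15897) splits by parity: `C1 ↔ DeficitOdd ∧ DeficitEven`

Line `Sketch` (lead c2 parity reshape, 2026-08-17) of crux stmt-Langlands-15897
`Summit.Langlands.Langlands.Theses.QuarterDeficit1951.QuarterFingerprintDeficit` (C1); strategist decomposition D1
(Cruxes/QuarterFingerprintDeficit/Lines/ParitySplit.lean), glue kernel-proved here over the LANDED parity closure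
`stub_parityClosure` (p158344) and its verbatim copies `IsForm`, `Tp`, `P₀` of the crux's `let`s.

`DeficitOdd` = C1 restricted to witnesses odd under `R : z ↦ -z̄` (numerically FALSE: the sighted `λ = 1/4`
Doud–Moore newforms are odd — so this is the sharpened refutation target); `DeficitEven` = C1 restricted to even
witnesses (plausibly true; an even-sector census; moot once `DeficitOdd` is refuted). A crux witness `u ≢ 0` has a
nonzero odd part `u − u∘R` or a nonzero even part `u + u∘R`, and by `ParityClosure` that part is again a witness.
What is PROVED (kernel-checked, no `sorry`): `QuarterFingerprintDeficit_of_deficitOdd_of_deficitEven`,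
`deficitOdd_of_deficit`, `deficitEven_of_deficit`, `deficit_iff_deficitOdd_and_deficitEven`.
-/

set_option linter.dupNamespace false

noncomputable section

namespace Summit.Langlands.Langlands.Theorems.QuarterFingerprintDeficit

open Summit.Langlands.Langlands.Theses.QuarterDeficit1951
open scoped ComplexConjugate MatrixGroups
open UpperHalfPlane (J)

/-- `Φ = {0, 1, 4, (3 ± √5)/2}` — projective fingerprint values `tr²/det` at elements of order 1,2,3,5 (verbatim the
crux's `let Φ`). -/
def fingerprintSet : Set ℂ := {0, 1, 4, (((3 + Real.sqrt 5) / 2 : ℝ) : ℂ), (((3 - Real.sqrt 5) / 2 : ℝ) : ℂ)}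

/-- The crux's windowed fingerprint clause at the six primes (verbatim, over the landed `Tp`, `P₀`). -/
def WindowFingerprint (χ : DirichletCharacter ℂ 1951) (u : UpperHalfPlane → ℂ) : Prop :=
  ∀ p ∈ P₀, ∃ μ φ : ℂ, φ ∈ fingerprintSet ∧ (∀ z, Tp χ p u z = μ * u z) ∧
    ‖μ ^ 2 * (starRingEnd ℂ) (χ (p : ZMod 1951)) - φ‖ ≤ 1 / 100

/-- SUB-CRUX `DeficitOdd`: C1 restricted to witnesses ODD under `R : z ↦ -z̄` (`UpperHalfPlane.J • z`). EXPECTED FALSE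
(the refutation target: the sighted λ = 1/4 Doud–Moore newforms are odd). A statement of the route's objects, decided by
computation; not a published theorem. -/
def DeficitOdd : Prop :=
  ∀ χ : DirichletCharacter ℂ 1951, orderOf χ = 5 → ¬ ∃ (u : UpperHalfPlane → ℂ) (lam : ℝ),
    IsForm χ u lam ∧ (∀ z, u (J • z) = - u z) ∧ (∃ z, u z ≠ 0) ∧ |lam - 1 / 4| ≤ 1 / 100 ∧ WindowFingerprint χ u

/-- SUB-CRUX `DeficitEven`: C1 restricted to witnesses EVEN under `R`. Plausibly true; certifiable only by an even-sector
census; moot for the refutation route once `DeficitOdd` is refuted. -/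
def DeficitEven : Prop :=
  ∀ χ : DirichletCharacter ℂ 1951, orderOf χ = 5 → ¬ ∃ (u : UpperHalfPlane → ℂ) (lam : ℝ),
    IsForm χ u lam ∧ (∀ z, u (J • z) = u z) ∧ (∃ z, u z ≠ 0) ∧ |lam - 1 / 4| ≤ 1 / 100 ∧ WindowFingerprint χ u

/-- `R` is an involution on `ℍ`. -/
theorem J_smul_J_smul_eq (z : UpperHalfPlane) : J • J • z = z := by
  rw [smul_smul, ← sq, UpperHalfPlane.J_sq, one_smul]

/-- **THE PARITY SPLIT**: `DeficitOdd → DeficitEven → QuarterFingerprintDeficit`. A crux witness `u ≢ 0` has a nonzero odd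
part `u − u∘R` or a nonzero even part `u + u∘R`; by the landed `stub_parityClosure` that part is again a witness (same `λ`,
same `T_p`-eigenvalues), of fixed parity. (`IsForm`/`Tp`/`P₀` are verbatim the crux's `let`s, so the crux unfolds to them.) -/
theorem QuarterFingerprintDeficit_of_deficitOdd_of_deficitEven (hO : DeficitOdd) (hE : DeficitEven) :
    QuarterFingerprintDeficit := by
  intro χ hχ hex
  obtain ⟨u, lam, hform, ⟨z₀, hz₀⟩, hwin, hfp⟩ := hex
  obtain ⟨⟨hformO, hformE⟩, hT⟩ := stub_parityClosure χ u lam hform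
  have hfpO : WindowFingerprint χ (fun z => u z - u (J • z)) := by
    intro p hp
    obtain ⟨μ, φ, hφ, hTu, hfin⟩ := hfp p hp
    exact ⟨μ, φ, hφ, (hT p hp μ hTu).1, hfin⟩
  have hfpE : WindowFingerprint χ (fun z => u z + u (J • z)) := by
    intro p hp
    obtain ⟨μ, φ, hφ, hTu, hfin⟩ := hfp p hp
    exact ⟨μ, φ, hφ, (hT p hp μ hTu).2, hfin⟩
  by_cases ho : ∃ z, u z - u (J • z) ≠ 0
  · exact hO χ hχ ⟨fun z => u z - u (J • z), lam, hformO,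
      fun z => by simp only [J_smul_J_smul_eq]; ring, ho, hwin, hfpO⟩
  · by_cases he : ∃ z, u z + u (J • z) ≠ 0
    · exact hE χ hχ ⟨fun z => u z + u (J • z), lam, hformE,
        fun z => by simp only [J_smul_J_smul_eq]; ring, he, hwin, hfpE⟩
    · push Not at ho he
      apply hz₀
      have h1 := ho z₀
      have h2 := he z₀
      linear_combination (h1 + h2) / 2

/-- The trivial direction: C1 implies its odd restriction. So a refutation of `DeficitOdd` is a refutation of C1. -/
theorem deficitOdd_of_deficit (h : QuarterFingerprintDeficit) : DeficitOdd := by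
  intro χ hχ ⟨u, lam, hform, _hodd, hne, hwin, hfp⟩
  exact h χ hχ ⟨u, lam, hform, hne, hwin, hfp⟩

/-- Likewise for the even restriction. -/
theorem deficitEven_of_deficit (h : QuarterFingerprintDeficit) : DeficitEven := by
  intro χ hχ ⟨u, lam, hform, _hev, hne, hwin, hfp⟩
  exact h χ hχ ⟨u, lam, hform, hne, hwin, hfp⟩

/-- **`C1 ↔ DeficitOdd ∧ DeficitEven`** — the kernel record that the crux splits by parity (ready for
`route edit --split QuarterFingerprintDeficit --into DeficitOdd DeficitEven`). -/
theorem deficit_iff_deficitOdd_and_deficitEven : QuarterFingerprintDeficit ↔ DeficitOdd ∧ DeficitEven :=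
  ⟨fun h => ⟨deficitOdd_of_deficit h, deficitEven_of_deficit h⟩,
    fun h => QuarterFingerprintDeficit_of_deficitOdd_of_deficitEven h.1 h.2⟩

end Summit.Langlands.Langlands.Theorems.QuarterFingerprintDeficit

end
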